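import Mathlib
import HarnessLib
import Literature.LinearAlgebra.Matrix.JacobiDerivativeFormula
import Literature.Combinatorics.SimpleGraph.ConeCharpolyAdjugate

/-!
# Equivariant-dc dial: the graded Schur complement of a block-gauge representation — Le Verrier's
# recursion for the graded pieces of `adj(1 + Z)` and `det(1 + Z)`, and the top-degree formula
# `f = ℓ · e_{m-1}(Z) − r · N_{m-2}(Z) · c` (decomp-valiant workshop, lens 1, generation 16) — support file of
# census cell A; NOT a route

HONEST FRAMING.  `VP ≠ VNP` is NOT proved here and nothing in this file is progress on it.  This is a
sorry-free SUPPORT file of the census cell `A = EquivariantDialNode.EqHardBiPerm` (item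
`stmt-ValiantsHypothesis-23702`).  It is the ALGEBRA of arrow 2 of the homogenisation theorem «Theorem H»
(`EquivariantDialGrading.GradingCost`; arrow 3 is `EquivariantDialLayersGraded`): from a BLOCK-GAUGE affine
determinantal representation `f = det [[ℓ, r], [c, 1 + Z]]` (all of `ℓ, r, c, Z` linear forms, `f` a form of
degree `m = d + 2`) one reads off the form `f` as the degree-`m` piece of the Schur complement
`ℓ det(1 + Z) − r adj(1 + Z) c`, and the graded pieces `E_p = [det(1+Z)]_p`, `N_p = [adj(1+Z)]_p` obey
LE VERRIER's linear recursion `N_0 = 1`, `N_{p+1} = E_{p+1} · 1 − Z N_p`, `(p+1) E_{p+1} = tr(Z N_p)` — which is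
what the equivariant LAYERED program of arrow 2 executes layer by layer.

## What is proved (kernel-checked, no `sorry`, no new axioms)

* §1 (any commutative ring `R`, `Z ∈ M_n(R)`; graded pieces := `X`-coefficients of the pencil `1 + X Z`):
  `lvN_zero` (`N_0 = 1`), `lvN_succ` (`N_{p+1} = E_{p+1} • 1 − Z N_p`, from `(1 + XZ) adj(1 + XZ) = det · 1`,
  Mathlib `Matrix.mul_adjugate`), `lvE_succ` (`(p+1) E_{p+1} = tr(Z N_p)`, from JACOBI's formula — the tree's
  `Literature.LinearAlgebra.Matrix.derivative_det_one_add_X_smul_eq_trace` [HornJohnson2013, 0.8.10]); this is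
  Le Verrier–Faddeev [Csanky1976; Berkowitz1984 §2 for the history].
* §2 (`k` a field, `R = k[x_σ]`): the DILATION homomorphism `x_i ↦ x_i · X` into `R[X]` multiplies a form of
  degree `d` by `X^d` (`dilate_of_isHomogeneous`) and carries `1 + Z` (`Z` linear) to the pencil `1 + X Z`
  (`mapMatrix_dilate_one_add`).
* §3 THE GRADED SCHUR COMPLEMENT (`eq_schur_top_of_det_border`): if `det [[ℓ, r], [c, 1 + Z]] = f` with
  `ℓ, r, c, Z` linear and `f` a form of degree `d + 2`, then `f = ℓ · E_{d+1} − r ⬝ (N_d c)` — Cauchy's bordered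
  determinant (the tree's `ConeCharpolyAdjugate.det_fromBlocks_unit_border` [Godsil1993, Ch. 2 Ex. 20]) after
  dilation, then the `X^{d+2}`-coefficient.

Census reading (workshop grammar): no new cell, no tag change; this file + `EquivariantDialLayersGraded` leave
exactly two Lean-open pieces of Theorem H for cell A: the equivariant layered PROGRAM executing §1 (arrow 2,
elementary) and the invariant BLOCK GAUGE (arrow 1, Wedderburn–Maschke; NODE-g13 §2 (1)–(2)).
No `instance`, no `notation`; nothing from `Literature` is restated.
-/

set_option linter.dupNamespace false

namespace Summit.ValiantsHypothesis.ValiantsHypothesis.Theorems.EquivariantDialLayers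

open Matrix

noncomputable section

/-! ## §1 Le Verrier's recursion for the graded pieces of `adj(1 + Z)` and `det(1 + Z)` -/

section LeVerrier

variable {R : Type*} [CommRing R] {n : Type*} [Fintype n] [DecidableEq n]

/-- The pencil `1 + X • Z ∈ M_n(R[X])`. -/
def lvPencil (Z : Matrix n n R) : Matrix n n (Polynomial R) :=
  (1 : Matrix n n (Polynomial R)) + (Polynomial.X : Polynomial R) • Z.map Polynomial.C

/-- `E_p(Z)` := the `X^p`-coefficient of `det(1 + X Z)` (the `p`-th elementary symmetric function of `Z`;
for `Z` a matrix of linear forms, the degree-`p` piece of `det(1 + Z)`). -/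
def lvE (Z : Matrix n n R) (p : ℕ) : R := (lvPencil Z).det.coeff p

/-- `N_p(Z)` := the matrix of `X^p`-coefficients of `adj(1 + X Z)` (for `Z` a matrix of linear forms, the
degree-`p` piece of `adj(1 + Z)`). -/
def lvN (Z : Matrix n n R) (p : ℕ) : Matrix n n R := fun i j => ((lvPencil Z).adjugate i j).coeff p

omit [Fintype n] in
/-- Entries of the pencil. -/
theorem lvPencil_apply (Z : Matrix n n R) (i j : n) :
    lvPencil Z i j = (1 : Matrix n n (Polynomial R)) i j + Polynomial.X * Polynomial.C (Z i j) := by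
  simp [lvPencil, Matrix.add_apply, Matrix.smul_apply, Matrix.map_apply, smul_eq_mul]

/-- The pencil at `X = 0` is the identity. -/
theorem mapMatrix_eval_zero_lvPencil (Z : Matrix n n R) :
    (Polynomial.evalRingHom (0 : R)).mapMatrix (lvPencil Z) = 1 := by
  have h0 : (Polynomial.evalRingHom (0 : R)).mapMatrix
      ((Polynomial.X : Polynomial R) • Z.map Polynomial.C) = 0 := by
    ext i j
    simp
  rw [lvPencil, map_add, map_one, h0, add_zero]

/-- `N_0 = 1` (`adj(1 + XZ)` at `X = 0` is `adj 1 = 1`). -/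
theorem lvN_zero (Z : Matrix n n R) : lvN Z 0 = 1 := by
  ext i j
  have h := RingHom.map_adjugate (Polynomial.evalRingHom (0 : R)) (lvPencil Z)
  rw [mapMatrix_eval_zero_lvPencil, adjugate_one] at h
  have hij := congrFun (congrFun h i) j
  rw [RingHom.mapMatrix_apply, Matrix.map_apply, Polynomial.coe_evalRingHom] at hij
  rw [lvN, Polynomial.coeff_zero_eq_eval_zero, hij]

/-- `N_{p+1} + Z N_p = E_{p+1} • 1`: the `X^{p+1}`-coefficient of `(1 + XZ) · adj(1 + XZ) = det(1 + XZ) · 1`. -/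
theorem lvN_succ_add (Z : Matrix n n R) (p : ℕ) : lvN Z (p + 1) + Z * lvN Z p = lvE Z (p + 1) • 1 := by
  ext i j
  have h := congrFun (congrFun (mul_adjugate (lvPencil Z)) i) j
  rw [Matrix.mul_apply, Matrix.smul_apply, smul_eq_mul] at h
  have hsplit : ∑ l, lvPencil Z i l * (lvPencil Z).adjugate l j =
      (lvPencil Z).adjugate i j + Polynomial.X * ∑ l, Polynomial.C (Z i l) * (lvPencil Z).adjugate l j := by
    simp only [lvPencil_apply, add_mul, Finset.sum_add_distrib, Matrix.one_apply, ite_mul, one_mul, zero_mul,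
      Finset.sum_ite_eq, Finset.mem_univ, if_true, Finset.mul_sum, mul_assoc]
  rw [hsplit] at h
  have hc := congrArg (fun q : Polynomial R => q.coeff (p + 1)) h
  simp only [Polynomial.coeff_add, Polynomial.coeff_X_mul, Polynomial.finsetSum_coeff,
    Polynomial.coeff_C_mul] at hc
  rw [Matrix.add_apply, Matrix.mul_apply, Matrix.smul_apply, Matrix.one_apply, smul_eq_mul]
  simp only [lvN, lvE]
  rw [hc, Matrix.one_apply]
  split_ifs with hij
  · rw [mul_one, mul_one]
  · rw [mul_zero, mul_zero, Polynomial.coeff_zero]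

/-- LE VERRIER, matrix half: `N_{p+1} = E_{p+1} • 1 − Z N_p`. -/
theorem lvN_succ (Z : Matrix n n R) (p : ℕ) : lvN Z (p + 1) = lvE Z (p + 1) • 1 - Z * lvN Z p :=
  eq_sub_of_add_eq (lvN_succ_add Z p)

/-- LE VERRIER, trace half (Jacobi's formula): `(p+1) E_{p+1} = tr(Z N_p)`. -/
theorem lvE_succ (Z : Matrix n n R) (p : ℕ) : lvE Z (p + 1) * ((p : R) + 1) = (Z * lvN Z p).trace := by
  have h := Literature.LinearAlgebra.Matrix.derivative_det_one_add_X_smul_eq_trace Z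
  have hc := congrArg (fun q : Polynomial R => q.coeff p) h
  simp only [Polynomial.coeff_derivative] at hc
  have hr : (((lvPencil Z).adjugate * Z.map Polynomial.C).trace).coeff p = (lvN Z p * Z).trace := by
    simp only [Matrix.trace, Matrix.diag, Matrix.mul_apply, Matrix.map_apply, Polynomial.finsetSum_coeff,
      Polynomial.coeff_mul_C, lvN]
  rw [Matrix.trace_mul_comm, ← hr]
  exact hc

/-- In a domain the pencil determinant `det(1 + XZ)` is a regular element (its constant term is `1`). -/
theorem isRegular_det_lvPencil [IsDomain R] (Z : Matrix n n R) : IsRegular (lvPencil Z).det := by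
  refine IsRegular.of_ne_zero fun h => ?_
  have h0 := congrArg (fun q : Polynomial R => q.coeff 0) h
  simp only [Polynomial.coeff_zero_eq_eval_zero] at h0
  rw [← Polynomial.coe_evalRingHom, RingHom.map_det, mapMatrix_eval_zero_lvPencil, det_one, map_zero] at h0
  exact one_ne_zero h0

end LeVerrier

/-! ## §2 The dilation homomorphism `x ↦ x · X` -/

section Dilate

variable (σ : Type*) (k : Type*) [CommRing k]

/-- The dilation homomorphism `x_i ↦ x_i · X : k[x_σ] → k[x_σ][X]` (it records the grading by degree). -/
def dilate : MvPolynomial σ k →ₐ[k] Polynomial (MvPolynomial σ k) :=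
  MvPolynomial.aeval fun i => Polynomial.C (MvPolynomial.X i) * Polynomial.X

variable {σ k}

/-- The dilation multiplies a form of degree `d` by `X ^ d`. -/
theorem dilate_of_isHomogeneous {f : MvPolynomial σ k} {d : ℕ} (hf : f.IsHomogeneous d) :
    dilate σ k f = Polynomial.C f * Polynomial.X ^ d := by
  classical
  conv_lhs => rw [← f.support_sum_monomial_coeff]
  conv_rhs => rw [← f.support_sum_monomial_coeff]
  rw [map_sum, map_sum, Finset.sum_mul]
  refine Finset.sum_congr rfl fun s hs => ?_
  rw [dilate, MvPolynomial.aeval_monomial, Polynomial.algebraMap_apply, MvPolynomial.algebraMap_eq,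
    ← hf (MvPolynomial.mem_support_iff.mp hs), MvPolynomial.monomial_eq]
  simp only [Finsupp.prod, mul_pow, Finset.prod_mul_distrib, Finset.prod_pow_eq_pow_sum, Finsupp.weight_apply,
    Pi.one_apply, smul_eq_mul, mul_one, Finsupp.sum, map_mul, map_prod, map_pow]
  ring

/-- In particular a linear form `ℓ` goes to `ℓ · X`. -/
theorem dilate_of_isHomogeneous_one {f : MvPolynomial σ k} (hf : f.IsHomogeneous 1) :
    dilate σ k f = Polynomial.C f * Polynomial.X := by
  rw [dilate_of_isHomogeneous hf, pow_one]

/-- The dilation carries `1 + Z` (`Z` a matrix of linear forms) to the pencil `1 + X Z`. -/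
theorem mapMatrix_dilate_one_add {n : Type*} [Fintype n] [DecidableEq n]
    {Z : Matrix n n (MvPolynomial σ k)} (hZ : ∀ i j, (Z i j).IsHomogeneous 1) :
    (dilate σ k).toRingHom.mapMatrix (1 + Z) = lvPencil Z := by
  rw [map_add, map_one, lvPencil]
  congr 1
  ext i j
  rw [RingHom.mapMatrix_apply, Matrix.map_apply, AlgHom.toRingHom_eq_coe, RingHom.coe_coe,
    dilate_of_isHomogeneous_one (hZ i j), Matrix.smul_apply, Matrix.map_apply, smul_eq_mul, mul_comm]

end Dilate

/-! ## §3 The graded Schur complement of a block-gauge representation -/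

section Schur

variable {σ : Type*} {k : Type*} [Field k] {n : Type*} [Fintype n] [DecidableEq n]

/-- The bordered matrix `[[ℓ, r], [c, 1 + Z]]` of a block-gauge affine representation (border = the
corank-one direction of the constant part, which is `diag(0, 1)`). -/
def border (ℓ : MvPolynomial σ k) (r c : n → MvPolynomial σ k) (Z : Matrix n n (MvPolynomial σ k)) :
    Matrix (Unit ⊕ n) (Unit ⊕ n) (MvPolynomial σ k) :=
  fromBlocks (of fun (_ _ : Unit) => ℓ) (of fun (_ : Unit) j => r j) (of fun i (_ : Unit) => c i) (1 + Z)

/-- **THE GRADED SCHUR COMPLEMENT.**  If `det [[ℓ, r], [c, 1 + Z]] = f` with `ℓ, r, c, Z` LINEAR forms and `f`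
a form of degree `d + 2`, then `f = ℓ · E_{d+1}(Z) − r ⬝ (N_d(Z) c)`: the degree-`(d+2)` piece of Cauchy's
bordered determinant `ℓ det(1+Z) − r adj(1+Z) c`. -/
theorem eq_schur_top_of_det_border {Z : Matrix n n (MvPolynomial σ k)} {r c : n → MvPolynomial σ k}
    {ℓ f : MvPolynomial σ k} {d : ℕ} (hZ : ∀ i j, (Z i j).IsHomogeneous 1)
    (hr : ∀ j, (r j).IsHomogeneous 1) (hc : ∀ i, (c i).IsHomogeneous 1) (hℓ : ℓ.IsHomogeneous 1)
    (hf : f.IsHomogeneous (d + 2)) (hdet : (border ℓ r c Z).det = f) :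
    f = ℓ * lvE Z (d + 1) - r ⬝ᵥ (lvN Z d *ᵥ c) := by
  set φ : MvPolynomial σ k →+* Polynomial (MvPolynomial σ k) := (dilate σ k).toRingHom with hφdef
  have hφ : ∀ g, φ g = dilate σ k g := fun g => rfl
  have hmap : φ.mapMatrix (border ℓ r c Z) =
      fromBlocks (of fun (_ _ : Unit) => Polynomial.C ℓ * Polynomial.X)
        (of fun (_ : Unit) j => Polynomial.C (r j) * Polynomial.X)
        (of fun i (_ : Unit) => Polynomial.C (c i) * Polynomial.X) (lvPencil Z) := by
    rw [RingHom.mapMatrix_apply, border, Matrix.fromBlocks_map, ← RingHom.mapMatrix_apply φ (1 + Z), hφdef,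
      mapMatrix_dilate_one_add hZ]
    congr 1
    · ext a b
      rw [Matrix.map_apply, of_apply, of_apply, ← dilate_of_isHomogeneous_one hℓ]
      rfl
    · ext a j
      rw [Matrix.map_apply, of_apply, of_apply, ← dilate_of_isHomogeneous_one (hr j)]
      rfl
    · ext i b
      rw [Matrix.map_apply, of_apply, of_apply, ← dilate_of_isHomogeneous_one (hc i)]
      rfl
  have hdet' := congrArg φ hdet
  rw [RingHom.map_det, hmap, Literature.Combinatorics.SimpleGraph.ConeCharpolyAdjugate.det_fromBlocks_unit_border
    _ _ _ _ (isRegular_det_lvPencil Z), hφ, dilate_of_isHomogeneous hf] at hdet'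
  have hterm : ∀ j i, ((Polynomial.C (r j) * Polynomial.X) *
      ((lvPencil Z).adjugate j i * (Polynomial.C (c i) * Polynomial.X))).coeff (d + 2) =
        r j * (lvN Z d j i * c i) := by
    intro j i
    have h2 : (Polynomial.C (r j) * Polynomial.X) * ((lvPencil Z).adjugate j i * (Polynomial.C (c i) * Polynomial.X))
        = Polynomial.X ^ 2 * (Polynomial.C (r j * c i) * (lvPencil Z).adjugate j i) := by
      rw [map_mul]; ring
    rw [h2, Polynomial.coeff_X_pow_mul, Polynomial.coeff_C_mul]
    simp only [lvN]
    ring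
  have e1 : (Polynomial.C ℓ * Polynomial.X * (lvPencil Z).det).coeff (d + 2) = ℓ * lvE Z (d + 1) := by
    rw [mul_assoc, Polynomial.coeff_C_mul, Polynomial.coeff_X_mul]
    rfl
  have e2 : ((fun j => Polynomial.C (r j) * Polynomial.X) ⬝ᵥ
      ((lvPencil Z).adjugate *ᵥ fun i => Polynomial.C (c i) * Polynomial.X)).coeff (d + 2) =
        r ⬝ᵥ (lvN Z d *ᵥ c) := by
    simp only [dotProduct, mulVec, Finset.mul_sum, Polynomial.finsetSum_coeff, hterm]
  have e3 : (Polynomial.C f * Polynomial.X ^ (d + 2)).coeff (d + 2) = f := by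
    rw [Polynomial.coeff_C_mul, Polynomial.coeff_X_pow_self, mul_one]
  have hco := congrArg (fun q : Polynomial (MvPolynomial σ k) => q.coeff (d + 2)) hdet'
  simp only [Polynomial.coeff_sub, e1, e2, e3] at hco
  exact hco.symm

end Schur

end

end Summit.ValiantsHypothesis.ValiantsHypothesis.Theorems.EquivariantDialLayers
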